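import Summits.AtomisticToContinuum.HydrodynamicLimit.Theorems.OneFlightGossipEngineEnergyCurrentTailsPedigreeObjects
import Literature.Analysis.FluidPDE.HardSphereCollisionTimeMeasurable
import Literature.Analysis.FluidPDE.HardSphereCollisionRecordMeasurable
import HarnessLib

/-!
# Line `pedigree-perpetuity` (crux `EnergyCurrentTails`, stmt-AtomisticToContinuum-9235):
# the backward energy lineage is measurable in the initial datum (stub `stub_lineageMeasurable`)

Helper file (`--supports stmt-AtomisticToContinuum-9235`) of the line lead (seat c3) proving the
registered stub `stub_lineageMeasurable : LineageMeasurable` of the checked skeleton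
`Cruxes/EnergyCurrentTails/Lines/pedigree_perpetuity.lean` over the line vocabulary
`…Theorems.OneFlightGossipEngineEnergyCurrentTailsPedigreeObjects` (`stepBack`, `lineage`,
`carrier`, `ltime`, `brecord`, `share`, `weight`, `termIndex`, `termCarrier`, `termWeight`,
`LineageMeasurable`).  The statement is spelled exactly as registered.

Content.  A `HardSphereFlow` only records that each time-`t` map is measurable; the lineage data
are `sSup`/`sInf`-functionals over a continuum of times of the orbit, so their measurability in the
datum is proved on the good set `Φ.good` (where orbits are hard-sphere trajectories) and
transported to Liouville-a.e. measurability by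
`HardSphereFlow.aemeasurable_of_measurable_comp_subtype` (`HardSphereFlowJointMeasurable`; the
good set is measurable and conull).  On the good set:

* `measurable_flightStart_good` — the flight start `flightStart … 0 (c z) (τ z)` of a
  measurable random particle `c` before a measurable random time `τ` is measurable: for a fixed
  particle it is the last zero before `τ` of the participation gauge of the orbit (`contactGauge`,
  continuous in time, measurable in the datum;
  `HardSphereFlow.collisionTimesOf_eq_setOf_contactGauge`, hitting-time lemma
  `measurable_sSup_insert_setOf_eq_zero` of `LoadedCollisionRecordMeasurable`),
  and the particle index ranges over the countable `Fin N` (`measurable_selectIdx`, from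
  `measurable_from_prod_countable_left`);
* `measurable_stepBack_good`, `measurable_lineage_good` — one backward step (flight start,
  configuration there by the joint measurability of the flow on `Φ.good × ℝ`, partner by
  `measurable_partner`, record by `HardSphereCollisionRecord.measurable_ofConfig₂_torus`,
  projectile choice by `Measurable.ite`) preserves measurability, hence the whole lineage is
  measurable by induction; so are `ltime`, `carrier`, `brecord`, `share`, `weight`;
* `measurable_sInf_setOf` — the `ℕ`-valued infimum of a sequence of measurable events is
  measurable (fibres), giving `termIndex`, and by `ℕ`-indexed selection `termCarrier`,
  `termWeight`;
* `stub_lineageMeasurable` — the registered statement (all `σ`, `s`: no sign condition needed).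

No new definitions; no dynamics beyond the structure fields of `HardSphereFlow`.

References: Gallagher–Saint-Raymond–Texier 2013 §4.1 (collision records, flights);
Cercignani–Illner–Pulvirenti 1994 App. 4.A.
-/

noncomputable section

open MeasureTheory Set Filter
open scoped ENNReal InnerProductSpace BigOperators

namespace Summit.AtomisticToContinuum.HydrodynamicLimit.Theorems.EnergyCurrentTailsPedigree

open Literature.MathematicalPhysics.KineticTheory Literature.Analysis.FluidPDE

/-! ## Measurability of the lineage data on the good set -/

section MeasurableLineage

variable {N : ℕ} {ε : ℝ} (Φ : HardSphereFlow (Torus.geometry (Fin 3)) ε N)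

/-- A countably-indexed family of measurable maps evaluated at a measurable random index is
measurable. [folklore] -/
theorem measurable_selectIdx {α β ι : Type*} [MeasurableSpace α] [MeasurableSpace β]
    [MeasurableSpace ι] [Countable ι] [MeasurableSingletonClass ι] {F : ι → α → β}
    {J : α → ι} (hF : ∀ j, Measurable (F j)) (hJ : Measurable J) :
    Measurable fun a => F (J a) a := by
  have h : Measurable fun p : α × ι => F p.2 p.1 := measurable_from_prod_countable_left hF
  exact h.comp (measurable_id.prodMk hJ)

/-- **Flight start at a random time of a random particle is measurable on the good set**: for a
measurable time `τ` and a measurable particle index `c` on `Φ.good`,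
`z ↦ flightStart … (orbit of z) 0 (c z) (τ z)` is measurable (last zero of the participation
gauge before `τ`, `measurable_sSup_insert_setOf_eq_zero`, then a countable selection).
[folklore] -/
theorem measurable_flightStart_good {τ : Φ.good → ℝ} {c : Φ.good → Fin N}
    (hτ : Measurable τ) (hc : Measurable c) :
    Measurable fun z : Φ.good => flightStart (Torus.geometry (Fin 3)) ε
      (fun r => Φ.flow r (z : Config N (Fin 3) T3)) 0 (c z) (τ z) := by
  have hk : ∀ k : Fin N, Measurable fun z : Φ.good => flightStart (Torus.geometry (Fin 3)) ε
      (fun r => Φ.flow r (z : Config N (Fin 3) T3)) 0 k (τ z) := by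
    intro k
    have hGc : Continuous fun p : T3 × T3 => ‖(Torus.geometry (Fin 3)).sepVec p.1 p.2‖ :=
      Torus.continuous_norm_reprSym.comp (continuous_fst.sub continuous_snd)
    have hcg : ∀ z : Φ.good, Continuous fun t =>
        contactGauge (Torus.geometry (Fin 3)) ε k
          fun l => (Φ.flow t (z : Config N (Fin 3) T3) l).1 :=
      fun z => (continuous_contactGauge (G := Torus.geometry (Fin 3)) (ε := ε) hGc k).comp
        (continuous_pi fun l => (Φ.isTrajectory (z : Config N (Fin 3) T3) z.2).pos_continuous l)
    have hmg : ∀ t, Measurable fun z : Φ.good =>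
        contactGauge (Torus.geometry (Fin 3)) ε k
          fun l => (Φ.flow t (z : Config N (Fin 3) T3) l).1 :=
      fun t => (measurable_contactGauge (G := Torus.geometry (Fin 3)) (ε := ε)
          Torus.measurable_geometry_sepVec k).comp
        ((measurable_pi_lambda _ fun l => (measurable_pi_apply l).fst).comp
          ((Φ.measurable_flow t).comp measurable_subtype_coe))
    have h : (fun z : Φ.good => flightStart (Torus.geometry (Fin 3)) ε
        (fun r => Φ.flow r (z : Config N (Fin 3) T3)) 0 k (τ z)) = fun z : Φ.good =>
        sSup (insert 0 ({t | contactGauge (Torus.geometry (Fin 3)) ε k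
          (fun l => (Φ.flow t (z : Config N (Fin 3) T3) l).1) = 0} ∩ Ioo 0 (τ z))) := by
      funext z
      rw [flightStart, Φ.collisionTimesOf_eq_setOf_contactGauge k z]
    rw [h]
    exact measurable_sSup_insert_setOf_eq_zero hcg hmg 0 hτ
  exact measurable_selectIdx hk hc

/-- The configuration of the orbit at a measurable random time is measurable on the good set
(joint measurability of the flow on `Φ.good × ℝ`). [folklore] -/
theorem measurable_flow_at_good {τ : Φ.good → ℝ} (hτ : Measurable τ) :
    Measurable fun z : Φ.good => Φ.flow (τ z) (z : Config N (Fin 3) T3) :=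
  Φ.measurable_flow_prod_torus.comp (measurable_id.prodMk hτ)

/-- The partner of a random particle at a random time is measurable on the good set. [folklore] -/
theorem measurable_partner_good {τ : Φ.good → ℝ} {c : Φ.good → Fin N} (hτ : Measurable τ)
    (hc : Measurable c) :
    Measurable fun z : Φ.good =>
      partner (Torus.geometry (Fin 3)) ε (Φ.flow (τ z) (z : Config N (Fin 3) T3)) (c z) :=
  measurable_selectIdx
    (fun k => (measurable_partner (G := Torus.geometry (Fin 3)) (ε := ε)
      Torus.measurable_geometry_sepVec k).comp (measurable_flow_at_good Φ hτ)) hc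

/-- The collision record of `(c, partner of c)` read off the orbit at a random time `τ` is
measurable on the good set (for measurable `τ`, `c`). [folklore] -/
theorem measurable_ofConfig_partner_good {τ : Φ.good → ℝ} {c : Φ.good → Fin N}
    (hτ : Measurable τ) (hc : Measurable c) :
    Measurable fun z : Φ.good =>
      HardSphereCollisionRecord.ofConfig (Torus.geometry (Fin 3)) ε
        (Φ.flow (τ z) (z : Config N (Fin 3) T3)) (τ z) (c z)
        (partner (Torus.geometry (Fin 3)) ε (Φ.flow (τ z) (z : Config N (Fin 3) T3)) (c z)) := by
  have hp : ∀ p : Fin N × Fin N, Measurable fun z : Φ.good =>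
      HardSphereCollisionRecord.ofConfig (Torus.geometry (Fin 3)) ε
        (Φ.flow (τ z) (z : Config N (Fin 3) T3)) (τ z) p.1 p.2 := fun p =>
    (HardSphereCollisionRecord.measurable_ofConfig₂_torus ε p.1 p.2).comp
      (hτ.prodMk (measurable_flow_at_good Φ hτ))
  exact measurable_selectIdx hp (hc.prodMk (measurable_partner_good Φ hτ hc))

/-- One backward step of the lineage preserves measurability on the good set. [folklore] -/
theorem measurable_stepBack_good {x : Φ.good → Fin N × ℝ} (hx : Measurable x) :
    Measurable fun z : Φ.good =>
      stepBack ε (fun r => Φ.flow r (z : Config N (Fin 3) T3)) (x z) := by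
  have hb := measurable_flightStart_good Φ hx.snd hx.fst
  have hrec := measurable_ofConfig_partner_good Φ hb hx.fst
  have hpart := measurable_partner_good Φ hb hx.fst
  have hpre := HardSphereCollisionRecord.measurable_preVel.comp hrec
  unfold stepBack
  exact (Measurable.ite (measurableSet_le hpre.snd.norm hpre.fst.norm) hx.fst hpart).prodMk hb

/-- **The backward lineage is measurable on the good set** (induction on the step). [folklore] -/
theorem measurable_lineage_good (i : Fin N) (s : ℝ) (n : ℕ) :
    Measurable fun z : Φ.good =>
      lineage ε (fun r => Φ.flow r (z : Config N (Fin 3) T3)) i s n := by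
  induction n with
  | zero => exact measurable_const
  | succ n ih => exact measurable_stepBack_good Φ ih

/-- The lineage times are measurable on the good set. [folklore] -/
theorem measurable_ltime_good (i : Fin N) (s : ℝ) (n : ℕ) :
    Measurable fun z : Φ.good => ltime ε (fun r => Φ.flow r (z : Config N (Fin 3) T3)) i s n :=
  (measurable_lineage_good Φ i s n).snd

/-- The lineage carriers are measurable on the good set. [folklore] -/
theorem measurable_carrier_good (i : Fin N) (s : ℝ) (n : ℕ) :
    Measurable fun z : Φ.good => carrier ε (fun r => Φ.flow r (z : Config N (Fin 3) T3)) i s n :=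
  (measurable_lineage_good Φ i s n).fst

/-- The records behind the lineage states are measurable on the good set. [folklore] -/
theorem measurable_brecord_good (i : Fin N) (s : ℝ) (n : ℕ) :
    Measurable fun z : Φ.good => brecord ε (fun r => Φ.flow r (z : Config N (Fin 3) T3)) i s n :=
  measurable_ofConfig_partner_good Φ (measurable_ltime_good Φ i s (n + 1))
    (measurable_carrier_good Φ i s n)

/-- The shares are measurable on the good set. [folklore] -/
theorem measurable_share_good (i : Fin N) (s : ℝ) (n : ℕ) :
    Measurable fun z : Φ.good =>
      share ε (fun r => Φ.flow r (z : Config N (Fin 3) T3)) i s n := by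
  have hrec := measurable_brecord_good Φ i s n
  have hpre := HardSphereCollisionRecord.measurable_preVel.comp hrec
  have himp := HardSphereCollisionRecord.measurable_impactVec.comp hrec
  unfold share
  exact Measurable.ite (measurableSet_le hpre.snd.norm hpre.fst.norm)
    (measurable_const.sub (((hpre.fst.inner himp).pow_const 2).div (hpre.fst.norm.pow_const 2)))
    (((hpre.snd.inner himp).pow_const 2).div (hpre.snd.norm.pow_const 2))

/-- The discount weights are measurable on the good set. [folklore] -/
theorem measurable_weight_good (i : Fin N) (s : ℝ) (n : ℕ) :
    Measurable fun z : Φ.good =>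
      weight ε (fun r => Φ.flow r (z : Config N (Fin 3) T3)) i s n := by
  unfold weight
  exact Finset.measurable_prod _ fun j _ => measurable_share_good Φ i s j

/-- The infimum of a sequence of measurable events, as an `ℕ`-valued map, is measurable (each
fibre `{sInf = k}` is a Boolean combination of the events). [folklore] -/
theorem measurable_sInf_setOf {α : Type*} [MeasurableSpace α] {p : ℕ → α → Prop}
    (hp : ∀ n, MeasurableSet {a | p n a}) : Measurable fun a => sInf {n | p n a} := by
  refine measurable_to_countable' fun k => ?_
  have hset : (fun a => sInf {n | p n a}) ⁻¹' {k} =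
      {a | (p k a ∧ ∀ m, m < k → ¬ p m a) ∨ ((∀ m, ¬ p m a) ∧ k = 0)} := by
    ext a
    simp only [mem_preimage, mem_singleton_iff, mem_setOf_eq]
    constructor
    · intro h
      by_cases hne : ({n | p n a} : Set ℕ).Nonempty
      · left
        refine ⟨?_, fun m hm => ?_⟩
        · have := Nat.sInf_mem hne
          rwa [h] at this
        · exact Nat.notMem_of_lt_sInf (h ▸ hm)
      · right
        rw [Set.not_nonempty_iff_eq_empty] at hne
        refine ⟨fun m hm => ?_, ?_⟩
        · have : m ∈ ({n | p n a} : Set ℕ) := hm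
          rw [hne] at this
          exact this
        · rw [← h, hne, Nat.sInf_empty]
    · rintro (⟨hk, hlt⟩ | ⟨hall, rfl⟩)
      · refine le_antisymm (Nat.sInf_le hk) ?_
        by_contra hlt'
        push Not at hlt'
        exact hlt _ hlt' (Nat.sInf_mem (s := {n | p n a}) ⟨k, hk⟩)
      · have : ({n | p n a} : Set ℕ) = ∅ := Set.eq_empty_of_forall_notMem fun m hm => hall m hm
        rw [this, Nat.sInf_empty]
  rw [hset]
  have hp' : ∀ n, Measurable fun a => p n a := fun n => measurableSet_setOf.1 (hp n)
  refine measurableSet_setOf.2 ?_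
  exact ((hp' k).and (Measurable.forall fun m => measurable_const.imp (hp' m).not)).or
    ((Measurable.forall fun m => (hp' m).not).and measurable_const)

/-- The terminal index is measurable on the good set. [folklore] -/
theorem measurable_termIndex_good (i : Fin N) (s : ℝ) :
    Measurable fun z : Φ.good =>
      termIndex ε (fun r => Φ.flow r (z : Config N (Fin 3) T3)) i s := by
  unfold termIndex Genuine
  exact measurable_sInf_setOf fun n =>
    (measurableSet_lt measurable_const (measurable_ltime_good Φ i s (n + 1))).compl

/-- The terminal carrier is measurable on the good set. [folklore] -/
theorem measurable_termCarrier_good (i : Fin N) (s : ℝ) :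
    Measurable fun z : Φ.good =>
      termCarrier ε (fun r => Φ.flow r (z : Config N (Fin 3) T3)) i s := by
  unfold termCarrier
  exact measurable_selectIdx (fun n => measurable_carrier_good Φ i s n)
    (measurable_termIndex_good Φ i s)

/-- The terminal weight is measurable on the good set. [folklore] -/
theorem measurable_termWeight_good (i : Fin N) (s : ℝ) :
    Measurable fun z : Φ.good =>
      termWeight ε (fun r => Φ.flow r (z : Config N (Fin 3) T3)) i s := by
  unfold termWeight
  exact measurable_selectIdx (fun n => measurable_weight_good Φ i s n)
    (measurable_termIndex_good Φ i s)

end MeasurableLineage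

/-! ## The registered stub -/

/-- **LINEAGE LEDGER, MEASURABLE PART** (registered stub `stub_lineageMeasurable` of the line
`pedigree-perpetuity`): for every flow of the crux frame, particle `i`, time `s` and index `n`, the
lineage time `τ_n`, the carrier `c_n`, the pre- and post-collisional velocities and the impact
vector of the record behind state `n`, the terminal carrier and the terminal weight are
Liouville-a.e. measurable functions of the initial datum (measurable on the conull good set). -/
theorem stub_lineageMeasurable : LineageMeasurable := by
  intro σ N Φ i s
  refine ⟨fun n => ⟨?_, ?_, ?_, ?_, ?_⟩, ?_, ?_⟩
  · exact Φ.aemeasurable_of_measurable_comp_subtype (measurable_ltime_good Φ i s n)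
      Φ.measure_compl_good
  · exact Φ.aemeasurable_of_measurable_comp_subtype (measurable_carrier_good Φ i s n)
      Φ.measure_compl_good
  · exact Φ.aemeasurable_of_measurable_comp_subtype
      (HardSphereCollisionRecord.measurable_preVel.comp (measurable_brecord_good Φ i s n))
      Φ.measure_compl_good
  · exact Φ.aemeasurable_of_measurable_comp_subtype
      (HardSphereCollisionRecord.measurable_postVel.comp (measurable_brecord_good Φ i s n))
      Φ.measure_compl_good
  · exact Φ.aemeasurable_of_measurable_comp_subtype
      (HardSphereCollisionRecord.measurable_impactVec.comp (measurable_brecord_good Φ i s n))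
      Φ.measure_compl_good
  · exact Φ.aemeasurable_of_measurable_comp_subtype (measurable_termCarrier_good Φ i s)
      Φ.measure_compl_good
  · exact Φ.aemeasurable_of_measurable_comp_subtype (measurable_termWeight_good Φ i s)
      Φ.measure_compl_good

end Summit.AtomisticToContinuum.HydrodynamicLimit.Theorems.EnergyCurrentTailsPedigree

end
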